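import Summits.CriticalPhenomena.Ising3DConformalLimit.Theses.FKParityRobustness
import Summits.CriticalPhenomena.Ising3DConformalLimit.Theorems.FKParityRobustnessIndependentStrandsJoinPinchToTetraDefs
import Summits.CriticalPhenomena.Ising3DConformalLimit.Theorems.FKParityRobustnessFarMergingGivesU4
import Literature.Probability.LatticeModels.CriticalUrsellFourSign
import Literature.Probability.LatticeModels.Sweep1
import Literature.Probability.LatticeModels.PointwiseScalingLimitTwoPointMono
import HarnessLib

/-!
# The ∃-shape dictionary (core): clause (iii) of a pointwise limit ⟹ far merging along SOME lattice shape

Helper file of the crux `IndependentStrandsJoin` (item stmt-CriticalPhenomena-14625, route `FKParityRobustness`;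
line `pinch-to-tetra`, revision r5, lead c5-0).  For a pointwise scaling limit `S` of a lattice family `G` on `ℤ³`
(`HasPointwiseScalingLimit G ρ S`; NO continuity of `S`, no covariance, no sign condition on `ρ`):
* `tendsto_limit_cellCentre` — **weak continuity along cell centres**: with `c_δ(x)_i = δ([x_i/δ] + ½·𝟙)`
  (`latticeApprox_cellCentre`: same lattice approximation as `x`; `tendsto_cellCentre`: `c_δ(x) → x`), for `x`
  non-coincident `S n (c_δ(x)) → S n (x)` as `δ → 0⁺` (local uniformity at `x` + cell-constancy of the rescaled lattice
  correlator); hence `U₄(S)(c_δ(x)) → U₄(S)(x)` (`tendsto_limitConnectedFour_cellCentre`).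
* `exists_latticeShape_of_limitConnectedFour_neg` — `U₄(S)(x) < 0` at ONE non-coincident `x` gives `U₄(S)((2M)⁻¹ • a) < 0`
  at a RATIONAL configuration (`a : Fin 4 → ℤ³` injective, `M ≥ 1`: the cell centre at mesh `1/M`).
* `shapeMergingEventually_of_limitConnectedFour_neg` — for `G = criticalCorr 3` and `S` non-degenerate, `U₄(S)(q • a) < 0`
  (`q > 0`, `a` injective) forces far merging along ALL large dilations of `a`:
  `∃ c > 0, ∃ L₁, ∀ L ≥ L₁, U₄^crit(L•a) ≤ −c·⟨σ_{La₀}σ_{La₁}⟩⟨σ_{La₂}σ_{La₃}⟩` (meshes `δ_L = q/L`, `[q•a/δ_L] = L•a` exactly,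
  `ρ⁴ ≥ 0` un-rescales); with the Lebowitz sign (`hasNontrivialU4_iff_exists_neg_of_hasPointwiseScalingLimit`) this is
  `exists_shapeMergingEventually_of_hasNontrivialU4` = the registered sub-goal `stub_shapeDictionary`.
With the landed glue `farMergingGivesU4_proof` (item stmt-CriticalPhenomena-4471) it yields the dictionary "under
`LimitExists`, `NonGaussianLimit` (item stmt-CriticalPhenomena-0636) ⟺ far merging along the dilations of SOME injective
lattice shape" (companion file `…ShapeResidual.lean`), so that modulo `LimitExists` the crux's residual over item 0636 is
the purely lattice SHAPE TRANSFER to the regular tetrahedra — Möbius covariance (r4's `TNVᴹ`) plays no role.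

References: M. Aizenman, Comm. Math. Phys. 86 (1982), §1, Prop. 5.3 (sign / far-merging form of `U₄`) [AizenmanCMP1982];
J. L. Lebowitz, Comm. Math. Phys. 35 (1974) 87–92 (`U₄ ≤ 0`, tree theorem `criticalUrsellFour_nonpos`) [Lebowitz1974].
-/

noncomputable section

open Filter Topology
open Literature.Probability.LatticeModels
open Summit.CriticalPhenomena.Ising3DConformalLimit.Theses.FKParityRobustness
open Summit.CriticalPhenomena.Ising3DConformalLimit.FKParityRobustnessFarMergingGivesU4
  (injective_vecCons_pair farMergingGivesU4_proof)

namespace Summit.CriticalPhenomena.Ising3DConformalLimit.Cruxes.IndependentStrandsJoin.PinchToTetra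

/-! ## Cell centres -/

section cellCentre

/-- The lattice approximation of the cell centre `δ([p/δ] + ½)` is `[p/δ]` again (`δ > 0`). [folklore] -/
theorem latticeApprox_cellCentre {δ : ℝ} (hδ : 0 < δ) (p : EuclideanSpace ℝ (Fin 3)) :
    latticeApprox δ (WithLp.toLp 2 fun k => δ * ((latticeApprox δ p k : ℝ) + 1 / 2) :
      EuclideanSpace ℝ (Fin 3)) = latticeApprox δ p := by
  funext k
  rw [latticeApprox_apply, PiLp.toLp_apply, mul_div_cancel_left₀ _ hδ.ne', Int.floor_intCast_add]
  have h : ⌊(1 / 2 : ℝ)⌋ = 0 := by norm_num [Int.floor_eq_iff]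
  rw [h, add_zero]

/-- Coordinates of the cell centre are within `δ/2` of the point (`δ > 0`). [folklore] -/
theorem abs_cellCentre_sub_le {δ : ℝ} (hδ : 0 < δ) (p : EuclideanSpace ℝ (Fin 3)) (k : Fin 3) :
    |δ * ((latticeApprox δ p k : ℝ) + 1 / 2) - p k| ≤ δ / 2 := by
  rw [latticeApprox_apply]
  have h1 : (⌊p k / δ⌋ : ℝ) ≤ p k / δ := Int.floor_le _
  have h2 : p k / δ < ⌊p k / δ⌋ + 1 := Int.lt_floor_add_one _
  have h1' : δ * (⌊p k / δ⌋ : ℝ) ≤ p k := by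
    have := mul_le_mul_of_nonneg_left h1 hδ.le
    rwa [mul_div_cancel₀ _ hδ.ne'] at this
  have h2' : p k < δ * (⌊p k / δ⌋ : ℝ) + δ := by
    have := mul_lt_mul_of_pos_left h2 hδ
    rwa [mul_div_cancel₀ _ hδ.ne', mul_add, mul_one] at this
  rw [abs_le]
  constructor <;> linarith

/-- The cell centre is within `δ` of the point in `ℝ³` (`δ > 0`). [folklore] -/
theorem norm_cellCentre_sub_le {δ : ℝ} (hδ : 0 < δ) (p : EuclideanSpace ℝ (Fin 3)) :
    ‖(WithLp.toLp 2 fun k => δ * ((latticeApprox δ p k : ℝ) + 1 / 2) : EuclideanSpace ℝ (Fin 3)) - p‖ ≤ δ := by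
  rw [EuclideanSpace.norm_eq]
  have hk : ∀ k : Fin 3, ‖((WithLp.toLp 2 fun k => δ * ((latticeApprox δ p k : ℝ) + 1 / 2) :
      EuclideanSpace ℝ (Fin 3)) - p) k‖ ^ 2 ≤ (δ / 2) ^ 2 := by
    intro k
    rw [Real.norm_eq_abs, sq_abs]
    have h := abs_cellCentre_sub_le hδ p k
    have h' : |((WithLp.toLp 2 fun k => δ * ((latticeApprox δ p k : ℝ) + 1 / 2) :
        EuclideanSpace ℝ (Fin 3)) - p) k| ≤ δ / 2 := by
      simpa using h
    rw [← sq_abs]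
    exact pow_le_pow_left₀ (abs_nonneg _) h' 2
  have hsum : ∑ k : Fin 3, ‖((WithLp.toLp 2 fun k => δ * ((latticeApprox δ p k : ℝ) + 1 / 2) :
      EuclideanSpace ℝ (Fin 3)) - p) k‖ ^ 2 ≤ δ ^ 2 := by
    calc ∑ k : Fin 3, ‖((WithLp.toLp 2 fun k => δ * ((latticeApprox δ p k : ℝ) + 1 / 2) :
          EuclideanSpace ℝ (Fin 3)) - p) k‖ ^ 2
        ≤ ∑ _k : Fin 3, (δ / 2) ^ 2 := Finset.sum_le_sum fun k _ => hk k
      _ = 3 * (δ / 2) ^ 2 := by simp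
      _ ≤ δ ^ 2 := by nlinarith
  calc √(∑ k : Fin 3, ‖((WithLp.toLp 2 fun k => δ * ((latticeApprox δ p k : ℝ) + 1 / 2) :
        EuclideanSpace ℝ (Fin 3)) - p) k‖ ^ 2) ≤ √(δ ^ 2) := Real.sqrt_le_sqrt hsum
    _ = δ := Real.sqrt_sq hδ.le

/-- **Cell centres converge**: for a configuration `x : Fin n → ℝ³`, the cell-centre configuration
`c_δ(x)_i = δ([x_i/δ] + ½)` tends to `x` as `δ → 0⁺`. [folklore] -/
theorem tendsto_cellCentre {n : ℕ} (x : Fin n → EuclideanSpace ℝ (Fin 3)) :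
    Tendsto (fun δ : ℝ => fun i => (WithLp.toLp 2 fun k => δ * ((latticeApprox δ (x i) k : ℝ) + 1 / 2) :
      EuclideanSpace ℝ (Fin 3))) (𝓝[>] (0 : ℝ)) (𝓝 x) := by
  rw [tendsto_pi_nhds]
  intro i
  rw [tendsto_iff_norm_sub_tendsto_zero]
  have hδ0 : Tendsto (fun δ : ℝ => δ) (𝓝[>] (0 : ℝ)) (𝓝 0) := tendsto_id.mono_left nhdsWithin_le_nhds
  refine squeeze_zero_norm' ?_ hδ0
  filter_upwards [self_mem_nhdsWithin] with δ hδ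
  rw [norm_norm]
  exact norm_cellCentre_sub_le hδ (x i)

end cellCentre

/-! ## Weak continuity of pointwise limits along cell centres -/

section limit

variable {G : LatticeCorrFamily 3} {ρ : ℝ → ℝ} {S : CorrFamily 3}

/-- **Weak continuity along cell centres.**  For a pointwise scaling limit `S` of any lattice family `G` and a
non-coincident configuration `x`, `S n (c_δ(x)) → S n (x)` as `δ → 0⁺`: the rescaled lattice correlator takes the
same value at `c_δ(x)` and at `x`, and converges locally uniformly near `x`. [folklore] -/
theorem tendsto_limit_cellCentre (hlim : HasPointwiseScalingLimit G ρ S) {n : ℕ}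
    {x : Fin n → EuclideanSpace ℝ (Fin 3)} (hx : x ∈ NonCoincident 3 n) :
    Tendsto (fun δ : ℝ => S n fun i => (WithLp.toLp 2 fun k => δ * ((latticeApprox δ (x i) k : ℝ) + 1 / 2) :
      EuclideanSpace ℝ (Fin 3))) (𝓝[>] (0 : ℝ)) (𝓝 (S n x)) := by
  -- local uniformity at `x`, composed with the cell centres `c_δ(x) → x`
  have hloc := ((isOpen_nonCoincident 3 n).tendstoLocallyUniformlyOn_iff_forall_tendsto.1 (hlim n)) x hx
  have hpair : Tendsto (fun δ : ℝ => (δ, fun i => (WithLp.toLp 2 fun k =>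
      δ * ((latticeApprox δ (x i) k : ℝ) + 1 / 2) : EuclideanSpace ℝ (Fin 3))))
      (𝓝[>] (0 : ℝ)) ((𝓝[>] (0 : ℝ)) ×ˢ 𝓝 x) := tendsto_id.prodMk (tendsto_cellCentre x)
  have hU := hloc.comp hpair
  -- the rescaled correlator at the cell centre equals the one at `x`, which converges to `S n x`
  have hat : Tendsto (fun δ : ℝ => rescaledCorrelator G ρ n δ fun i => (WithLp.toLp 2 fun k =>
      δ * ((latticeApprox δ (x i) k : ℝ) + 1 / 2) : EuclideanSpace ℝ (Fin 3)))
      (𝓝[>] (0 : ℝ)) (𝓝 (S n x)) := by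
    refine ((hlim n).tendsto_at hx).congr' ?_
    filter_upwards [self_mem_nhdsWithin] with δ hδ
    simp only [rescaledCorrelator_apply, latticeApprox_cellCentre hδ]
  exact hat.congr_uniformity (hU.uniformity_symm)

/-- Pairs of a cell-centre configuration are the cell-centre configuration of the pair. [folklore] -/
theorem cellCentre_pair (δ : ℝ) (x : Fin 4 → EuclideanSpace ℝ (Fin 3)) (a b : Fin 4) :
    (![(WithLp.toLp 2 fun k => δ * ((latticeApprox δ (x a) k : ℝ) + 1 / 2) : EuclideanSpace ℝ (Fin 3)),
       (WithLp.toLp 2 fun k => δ * ((latticeApprox δ (x b) k : ℝ) + 1 / 2) : EuclideanSpace ℝ (Fin 3))] :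
        Fin 2 → EuclideanSpace ℝ (Fin 3)) =
      fun i => (WithLp.toLp 2 fun k => δ * ((latticeApprox δ (![x a, x b] i) k : ℝ) + 1 / 2) :
        EuclideanSpace ℝ (Fin 3)) := by
  funext i
  fin_cases i <;> rfl

/-- **`U₄(S)` along cell centres**: `U₄(S)(c_δ(x)) → U₄(S)(x)` as `δ → 0⁺` for non-coincident `x`. [folklore] -/
theorem tendsto_limitConnectedFour_cellCentre (hlim : HasPointwiseScalingLimit G ρ S)
    {x : Fin 4 → EuclideanSpace ℝ (Fin 3)} (hx : x ∈ NonCoincident 3 4) :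
    Tendsto (fun δ : ℝ => limitConnectedFour S fun i => (WithLp.toLp 2 fun k =>
      δ * ((latticeApprox δ (x i) k : ℝ) + 1 / 2) : EuclideanSpace ℝ (Fin 3)))
      (𝓝[>] (0 : ℝ)) (𝓝 (limitConnectedFour S x)) := by
  have hinj : Function.Injective x := hx
  have h4 := tendsto_limit_cellCentre hlim (n := 4) hx
  have h2 : ∀ a b : Fin 4, a ≠ b → Tendsto (fun δ : ℝ => S 2
      ![(WithLp.toLp 2 fun k => δ * ((latticeApprox δ (x a) k : ℝ) + 1 / 2) : EuclideanSpace ℝ (Fin 3)),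
        (WithLp.toLp 2 fun k => δ * ((latticeApprox δ (x b) k : ℝ) + 1 / 2) : EuclideanSpace ℝ (Fin 3))])
      (𝓝[>] (0 : ℝ)) (𝓝 (S 2 ![x a, x b])) := by
    intro a b hab
    have hmem : (![x a, x b] : Fin 2 → EuclideanSpace ℝ (Fin 3)) ∈ NonCoincident 3 2 :=
      injective_vecCons_pair (hinj.ne hab)
    refine (tendsto_limit_cellCentre hlim (n := 2) hmem).congr fun δ => ?_
    rw [cellCentre_pair]
  simp only [limitConnectedFour]
  exact h4.sub ((((h2 0 1 (by decide)).mul (h2 2 3 (by decide))).add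
    ((h2 0 2 (by decide)).mul (h2 1 3 (by decide)))).add ((h2 0 3 (by decide)).mul (h2 1 2 (by decide))))

/-! ## From one negative value of `U₄(S)` to a rational configuration -/

/-- The lattice approximation of a non-coincident configuration is injective for small `δ`.
[folklore] -/
-- adapted from Cruxes/IsingEuclidUpgradeR4NonGaussian/Disproof.lean (`eventually_injective_latticeApprox`)
theorem eventually_injective_latticeApprox_of_mem {n : ℕ} {x : Fin n → EuclideanSpace ℝ (Fin 3)}
    (hx : x ∈ NonCoincident 3 n) :
    ∀ᶠ δ in 𝓝[>] (0:ℝ), Function.Injective fun i => latticeApprox δ (x i) := by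
  have hinj : Function.Injective x := hx
  have hpair : ∀ i j : Fin n, i ≠ j →
      ∀ᶠ δ in 𝓝[>] (0:ℝ), latticeApprox δ (x i) ≠ latticeApprox δ (x j) := by
    intro i j hij
    have hr : 0 < ‖WithLp.ofLp (x i) - WithLp.ofLp (x j)‖ := by
      rw [norm_pos_iff, sub_ne_zero]
      exact fun h => hij (hinj ((WithLp.ofLp_injective 2) h))
    have hm : Set.Ioo (0:ℝ) (‖WithLp.ofLp (x i) - WithLp.ofLp (x j)‖ / 3) ∈ 𝓝[>] (0:ℝ) :=
      Ioo_mem_nhdsGT (by positivity)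
    filter_upwards [hm] with δ hδ heq
    have h := le_supNorm_latticeApprox_sub (d := 3) (by norm_num) hδ.1 (x i) (x j)
    rw [heq, sub_self] at h
    have h0 : (Site.supNorm (0 : Site 3) : ℝ) = 0 := by
      rw [← Site.norm_eq_supNorm]; simp
    rw [h0] at h
    have := hδ.2
    rw [lt_div_iff₀ (by norm_num : (0:ℝ) < 3)] at this
    rw [sub_nonpos, div_le_iff₀ hδ.1] at h
    linarith
  have hall : ∀ᶠ δ in 𝓝[>] (0:ℝ), ∀ i j : Fin n,
      latticeApprox δ (x i) = latticeApprox δ (x j) → i = j := by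
    refine Filter.eventually_all.2 fun i => Filter.eventually_all.2 fun j => ?_
    by_cases hij : i = j
    · exact Filter.Eventually.of_forall fun δ _ => hij
    · exact (hpair i j hij).mono fun δ hδ h => absurd h hδ
  exact hall.mono fun δ h => fun i j hij => h i j hij

/-- `siteVec : ℤ³ → ℝ³` is injective. [folklore] -/
theorem siteVec_injective' : Function.Injective (siteVec : Site 3 → EuclideanSpace ℝ (Fin 3)) :=
  fun u v h => funext fun k => by simpa using congrArg (fun w : EuclideanSpace ℝ (Fin 3) => w k) h

/-- **A negative value of `U₄(S)` propagates to a rational configuration.**  If `U₄(S)(x) < 0` at one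
non-coincident `x`, then `U₄(S)((2M)⁻¹ • a) < 0` for some `M ≥ 1` and some INJECTIVE lattice shape
`a : Fin 4 → ℤ³` (the cell centre of `x` at mesh `1/M` has the half-integer coordinates `a/(2M)`). [folklore] -/
theorem exists_latticeShape_of_limitConnectedFour_neg (hlim : HasPointwiseScalingLimit G ρ S)
    {x : Fin 4 → EuclideanSpace ℝ (Fin 3)} (hx : x ∈ NonCoincident 3 4) (hneg : limitConnectedFour S x < 0) :
    ∃ M : ℕ, 0 < M ∧ ∃ a : Fin 4 → Site 3, Function.Injective a ∧
      limitConnectedFour S (fun i => ((2 * M : ℕ) : ℝ)⁻¹ • siteVec (a i)) < 0 := by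
  have hev1 : ∀ᶠ δ in 𝓝[>] (0:ℝ), limitConnectedFour S (fun i => (WithLp.toLp 2 fun k =>
      δ * ((latticeApprox δ (x i) k : ℝ) + 1 / 2) : EuclideanSpace ℝ (Fin 3))) < 0 :=
    (tendsto_limitConnectedFour_cellCentre hlim hx).eventually (gt_mem_nhds hneg)
  have hev2 := eventually_injective_latticeApprox_of_mem hx
  have hM : Tendsto (fun M : ℕ => ((M : ℝ))⁻¹) atTop (𝓝[>] (0 : ℝ)) :=
    tendsto_inv_atTop_nhdsGT_zero.comp tendsto_natCast_atTop_atTop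
  obtain ⟨M, hMpos, hneg', hinj'⟩ :=
    ((eventually_gt_atTop 0).and ((hM.eventually hev1).and (hM.eventually hev2))).exists
  refine ⟨M, hMpos, fun i k => 2 * latticeApprox ((M : ℝ))⁻¹ (x i) k + 1, ?_, ?_⟩
  · intro i j hij
    have h' : latticeApprox ((M : ℝ))⁻¹ (x i) = latticeApprox ((M : ℝ))⁻¹ (x j) := by
      funext k
      have h1 : 2 * latticeApprox ((M : ℝ))⁻¹ (x i) k + 1 = 2 * latticeApprox ((M : ℝ))⁻¹ (x j) k + 1 :=
        congrFun hij k
      omega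
    exact hinj' h'
  · convert hneg' using 2
    funext i
    ext k
    simp only [PiLp.smul_apply, siteVec_apply, smul_eq_mul]
    have hM0 : (M : ℝ) ≠ 0 := by exact_mod_cast hMpos.ne'
    push_cast
    field_simp

/-! ## Far merging along the dilations of a lattice shape -/

/-- Exactness of the lattice approximation along dilations of a scaled lattice configuration: at mesh
`δ = q/L`, `[q•u/δ] = L • u` (`q > 0`; also for `L = 0` by the junk value `q/0 = 0`). [folklore] -/
theorem latticeApprox_div_smul_siteVec {q : ℝ} (hq : 0 < q) (L : ℕ) (u : Site 3) :
    latticeApprox (q / L) (q • siteVec u) = (L : ℤ) • u := by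
  funext k
  simp only [latticeApprox_apply, PiLp.smul_apply, siteVec_apply, smul_eq_mul, Pi.smul_apply]
  rcases Nat.eq_zero_or_pos L with hL | hL
  · subst hL
    simp
  · have hL' : (L : ℝ) ≠ 0 := by exact_mod_cast hL.ne'
    have h : q * (u k : ℝ) / (q / L) = (((L : ℤ) * u k : ℤ) : ℝ) := by
      push_cast
      field_simp
    rw [h, Int.floor_intCast]

/-- **`U₄(S)(q • a) < 0` ⟹ far merging along ALL large dilations of the lattice shape `a`.**  For a non-degenerate
pointwise scaling limit `S` of the critical correlators on `ℤ³` (any renormalisation `ρ`): along the meshes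
`δ_L = q/L` the rescaled lattice Ursell function `ρ⁴U₄^crit(L•a)` converges to `A := U₄(S)(q•a) < 0` and `ρ⁴⟨σσ⟩⟨σσ⟩`
to `B := S₂S₂ > 0`; with `c = −A/(2B)` eventually `ρ⁴(U₄ + c⟨σσ⟩⟨σσ⟩) < 0`, and `ρ⁴ ≥ 0` un-rescales.
(Aizenman's far-merging form of `U₄`, Comm. Math. Phys. 86 (1982), Prop. 5.3, read backwards from the limit.)
[folklore] -/
theorem shapeMergingEventually_of_limitConnectedFour_neg
    (hlim : HasPointwiseScalingLimit (criticalCorr 3) ρ S) (hnd : IsNondegenerateTwoPoint S)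
    {q : ℝ} (hq : 0 < q) {a : Fin 4 → Site 3} (ha : Function.Injective a)
    (hneg : limitConnectedFour S (fun i => q • siteVec (a i)) < 0) :
    ∃ c : ℝ, 0 < c ∧ ∃ L₁ : ℕ, ∀ L : ℕ, L₁ ≤ L →
      criticalCorr 3 4 (fun i => (L : ℤ) • a i) -
          (criticalCorr 3 2 ![(L : ℤ) • a 0, (L : ℤ) • a 1] * criticalCorr 3 2 ![(L : ℤ) • a 2, (L : ℤ) • a 3] +
            criticalCorr 3 2 ![(L : ℤ) • a 0, (L : ℤ) • a 2] * criticalCorr 3 2 ![(L : ℤ) • a 1, (L : ℤ) • a 3] +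
            criticalCorr 3 2 ![(L : ℤ) • a 0, (L : ℤ) • a 3] * criticalCorr 3 2 ![(L : ℤ) • a 1, (L : ℤ) • a 2]) ≤
        -(c * (criticalCorr 3 2 ![(L : ℤ) • a 0, (L : ℤ) • a 1] * criticalCorr 3 2 ![(L : ℤ) • a 2, (L : ℤ) • a 3])) := by
  set y : Fin 4 → EuclideanSpace ℝ (Fin 3) := fun i => q • siteVec (a i) with hy_def
  have hy : Function.Injective y := fun i j hij =>
    ha (siteVec_injective' (smul_right_injective (EuclideanSpace ℝ (Fin 3)) hq.ne' hij))
  set δ : ℕ → ℝ := fun L => q / L with hδ_def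
  have hδ : Tendsto δ atTop (𝓝[>] (0 : ℝ)) := by
    rw [tendsto_nhdsWithin_iff]
    refine ⟨tendsto_const_div_atTop_nhds_zero_nat q, ?_⟩
    filter_upwards [eventually_gt_atTop 0] with L hL
    exact div_pos hq (by exact_mod_cast hL)
  have hz : ∀ (L : ℕ) (i : Fin 4), latticeApprox (δ L) (y i) = (L : ℤ) • a i :=
    fun L i => latticeApprox_div_smul_siteVec hq L (a i)
  have h4 : Tendsto (fun L : ℕ => ρ (δ L) ^ 4 * criticalCorr 3 4 (fun i => (L : ℤ) • a i)) atTop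
      (𝓝 (S 4 y)) := by
    have hy' : y ∈ NonCoincident 3 4 := hy
    refine (((hlim 4).tendsto_at hy').comp hδ).congr fun L => ?_
    have hzL : (fun i => latticeApprox (δ L) (y i)) = fun i => (L : ℤ) • a i := funext (hz L)
    simp only [Function.comp_apply, rescaledCorrelator_apply, hzL]
  have h2 : ∀ i j : Fin 4, i ≠ j →
      Tendsto (fun L : ℕ => ρ (δ L) ^ 2 * criticalCorr 3 2 ![(L : ℤ) • a i, (L : ℤ) • a j]) atTop
        (𝓝 (S 2 ![y i, y j])) := by
    intro i j hij
    have hmem : ![y i, y j] ∈ NonCoincident 3 2 := injective_vecCons_pair (hy.ne hij)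
    refine (((hlim 2).tendsto_at hmem).comp hδ).congr fun L => ?_
    have hzL : (fun k => latticeApprox (δ L) (![y i, y j] k)) = ![(L : ℤ) • a i, (L : ℤ) • a j] := by
      funext k
      fin_cases k <;> simp [hz]
    simp only [Function.comp_apply, rescaledCorrelator_apply, hzL]
  set A : ℝ := limitConnectedFour S y with hAdef
  set B : ℝ := S 2 ![y 0, y 1] * S 2 ![y 2, y 3] with hB
  have hBpos : 0 < B :=
    mul_pos (hnd _ (injective_vecCons_pair (hy.ne (by decide))))
      (hnd _ (injective_vecCons_pair (hy.ne (by decide))))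
  have hU : Tendsto (fun L : ℕ => ρ (δ L) ^ 4 * (criticalCorr 3 4 (fun i => (L : ℤ) • a i) -
      (criticalCorr 3 2 ![(L : ℤ) • a 0, (L : ℤ) • a 1] * criticalCorr 3 2 ![(L : ℤ) • a 2, (L : ℤ) • a 3] +
        criticalCorr 3 2 ![(L : ℤ) • a 0, (L : ℤ) • a 2] * criticalCorr 3 2 ![(L : ℤ) • a 1, (L : ℤ) • a 3] +
        criticalCorr 3 2 ![(L : ℤ) • a 0, (L : ℤ) • a 3] * criticalCorr 3 2 ![(L : ℤ) • a 1, (L : ℤ) • a 2])))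
      atTop (𝓝 A) := by
    have h := h4.sub ((((h2 0 1 (by decide)).mul (h2 2 3 (by decide))).add
      ((h2 0 2 (by decide)).mul (h2 1 3 (by decide)))).add
      ((h2 0 3 (by decide)).mul (h2 1 2 (by decide))))
    refine h.congr fun L => ?_
    ring
  have hG : Tendsto (fun L : ℕ => ρ (δ L) ^ 4 *
      (criticalCorr 3 2 ![(L : ℤ) • a 0, (L : ℤ) • a 1] * criticalCorr 3 2 ![(L : ℤ) • a 2, (L : ℤ) • a 3]))
      atTop (𝓝 B) := by
    have h := (h2 0 1 (by decide)).mul (h2 2 3 (by decide))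
    refine h.congr fun L => ?_
    ring
  -- the constant
  set c : ℝ := -A / (2 * B) with hc
  have hApos : A < 0 := hneg
  have hcpos : 0 < c := div_pos (by linarith) (by positivity)
  have hnegc : A + c * B < 0 := by
    have : c * B = -A / 2 := by rw [hc]; field_simp
    rw [this]; linarith
  have hev : ∀ᶠ L in atTop, ρ (δ L) ^ 4 * (criticalCorr 3 4 (fun i => (L : ℤ) • a i) -
      (criticalCorr 3 2 ![(L : ℤ) • a 0, (L : ℤ) • a 1] * criticalCorr 3 2 ![(L : ℤ) • a 2, (L : ℤ) • a 3] +
        criticalCorr 3 2 ![(L : ℤ) • a 0, (L : ℤ) • a 2] * criticalCorr 3 2 ![(L : ℤ) • a 1, (L : ℤ) • a 3] +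
        criticalCorr 3 2 ![(L : ℤ) • a 0, (L : ℤ) • a 3] * criticalCorr 3 2 ![(L : ℤ) • a 1, (L : ℤ) • a 2])) +
      c * (ρ (δ L) ^ 4 *
        (criticalCorr 3 2 ![(L : ℤ) • a 0, (L : ℤ) • a 1] * criticalCorr 3 2 ![(L : ℤ) • a 2, (L : ℤ) • a 3])) < 0 :=
    (hU.add (hG.const_mul c)).eventually (gt_mem_nhds hnegc)
  obtain ⟨L₁, hL₁⟩ := Filter.eventually_atTop.1 hev
  refine ⟨c, hcpos, L₁, fun L hL => ?_⟩
  have hlt := hL₁ L hL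
  have hρ4 : 0 ≤ ρ (δ L) ^ 4 := by positivity
  have key : ρ (δ L) ^ 4 * ((criticalCorr 3 4 (fun i => (L : ℤ) • a i) -
      (criticalCorr 3 2 ![(L : ℤ) • a 0, (L : ℤ) • a 1] * criticalCorr 3 2 ![(L : ℤ) • a 2, (L : ℤ) • a 3] +
        criticalCorr 3 2 ![(L : ℤ) • a 0, (L : ℤ) • a 2] * criticalCorr 3 2 ![(L : ℤ) • a 1, (L : ℤ) • a 3] +
        criticalCorr 3 2 ![(L : ℤ) • a 0, (L : ℤ) • a 3] * criticalCorr 3 2 ![(L : ℤ) • a 1, (L : ℤ) • a 2])) +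
      c * (criticalCorr 3 2 ![(L : ℤ) • a 0, (L : ℤ) • a 1] * criticalCorr 3 2 ![(L : ℤ) • a 2, (L : ℤ) • a 3])) < 0 := by
    have e : ∀ u g : ℝ, ρ (δ L) ^ 4 * (u + c * g) = ρ (δ L) ^ 4 * u + c * (ρ (δ L) ^ 4 * g) := fun u g => by ring
    rw [e]; exact hlt
  have := neg_of_mul_neg_right key hρ4
  linarith

/-- **`HasNontrivialU4 S` ⟹ far merging along the dilations of SOME injective lattice shape** (for a non-degenerate
pointwise scaling limit `S` of `criticalCorr 3`, any `ρ`): clause (iii) is witnessed at one non-coincident `x`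
(`hasNontrivialU4_iff_exists_neg_of_hasPointwiseScalingLimit`, Lebowitz sign), propagated to a rational configuration
(`exists_latticeShape_of_limitConnectedFour_neg`), and read back on the lattice
(`shapeMergingEventually_of_limitConnectedFour_neg`). [folklore] -/
theorem exists_shapeMergingEventually_of_hasNontrivialU4
    (hlim : HasPointwiseScalingLimit (criticalCorr 3) ρ S) (hnd : IsNondegenerateTwoPoint S)
    (hU : HasNontrivialU4 S) :
    ∃ c : ℝ, 0 < c ∧ ∃ a : Fin 4 → Site 3, Function.Injective a ∧ ∃ L₁ : ℕ, ∀ L : ℕ, L₁ ≤ L →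
      criticalCorr 3 4 (fun i => (L : ℤ) • a i) -
          (criticalCorr 3 2 ![(L : ℤ) • a 0, (L : ℤ) • a 1] * criticalCorr 3 2 ![(L : ℤ) • a 2, (L : ℤ) • a 3] +
            criticalCorr 3 2 ![(L : ℤ) • a 0, (L : ℤ) • a 2] * criticalCorr 3 2 ![(L : ℤ) • a 1, (L : ℤ) • a 3] +
            criticalCorr 3 2 ![(L : ℤ) • a 0, (L : ℤ) • a 3] * criticalCorr 3 2 ![(L : ℤ) • a 1, (L : ℤ) • a 2]) ≤
        -(c * (criticalCorr 3 2 ![(L : ℤ) • a 0, (L : ℤ) • a 1] * criticalCorr 3 2 ![(L : ℤ) • a 2, (L : ℤ) • a 3])) := by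
  obtain ⟨x, hx, hneg⟩ := (hasNontrivialU4_iff_exists_neg_of_hasPointwiseScalingLimit le_rfl hlim).1 hU
  obtain ⟨M, hM, a, ha, hneg'⟩ := exists_latticeShape_of_limitConnectedFour_neg hlim hx hneg
  have hq : (0 : ℝ) < ((2 * M : ℕ) : ℝ)⁻¹ := by positivity
  obtain ⟨c, hc, L₁, hev⟩ := shapeMergingEventually_of_limitConnectedFour_neg hlim hnd hq ha hneg'
  exact ⟨c, hc, a, ha, L₁, hev⟩

end limit

end Summit.CriticalPhenomena.Ising3DConformalLimit.Cruxes.IndependentStrandsJoin.PinchToTetra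

/-! ## The registered sub-goal `stub_shapeDictionary` -/

namespace Summit.CriticalPhenomena.Ising3DConformalLimit.Theorems

open Summit.CriticalPhenomena.Ising3DConformalLimit.Cruxes.IndependentStrandsJoin.PinchToTetra

/-- **Registered sub-goal `stub_shapeDictionary` of the crux `IndependentStrandsJoin`** (stmt-CriticalPhenomena-14625,
line `pinch-to-tetra` r5): for every non-degenerate pointwise scaling limit `S` of `criticalCorr 3` (any `ρ`),
`HasNontrivialU4 S` forces far merging of the critical lattice Ursell function along ALL large dilations of SOME
injective lattice shape (`PinchToTetra.exists_shapeMergingEventually_of_hasNontrivialU4`). -/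
theorem stub_shapeDictionary :
    ∀ (ρ : ℝ → ℝ) (S : CorrFamily 3), HasPointwiseScalingLimit (criticalCorr 3) ρ S →
      IsNondegenerateTwoPoint S → HasNontrivialU4 S →
      ∃ c : ℝ, 0 < c ∧ ∃ a : Fin 4 → Site 3, Function.Injective a ∧ ∃ L₁ : ℕ, ∀ L : ℕ, L₁ ≤ L →
        criticalCorr 3 4 (fun i => (L : ℤ) • a i) -
            (criticalCorr 3 2 ![(L : ℤ) • a 0, (L : ℤ) • a 1] * criticalCorr 3 2 ![(L : ℤ) • a 2, (L : ℤ) • a 3] +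
              criticalCorr 3 2 ![(L : ℤ) • a 0, (L : ℤ) • a 2] * criticalCorr 3 2 ![(L : ℤ) • a 1, (L : ℤ) • a 3] +
              criticalCorr 3 2 ![(L : ℤ) • a 0, (L : ℤ) • a 3] * criticalCorr 3 2 ![(L : ℤ) • a 1, (L : ℤ) • a 2]) ≤
          -(c * (criticalCorr 3 2 ![(L : ℤ) • a 0, (L : ℤ) • a 1] * criticalCorr 3 2 ![(L : ℤ) • a 2, (L : ℤ) • a 3])) :=
  fun _ _ hlim hnd hU => exists_shapeMergingEventually_of_hasNontrivialU4 hlim hnd hU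

end Summit.CriticalPhenomena.Ising3DConformalLimit.Theorems

end
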